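import Literature.NumberTheory.ConnesConsani2021.QuantizedDiffKernelFourier
import Literature.NumberTheory.ConnesConsani2021.QuadrantKernelL2
import HarnessLib

/-!
# `[H, f]φ` through the frequency-side kernel: `∫ k_f(s,t)φ(t)dt = −2∫ e^{2πisξ} ∫ b_f(ξ,η) φ̂(η) dη dξ`

RH-FREE analysis (cell `rh-crit`, sub-cell cc, seat t13; a brick of the planned discharge of the tree fact
`CC2021_lemma_D47`, App. D Lemma D.1 (47) of Connes–Consani 2021: "`[H, f] = 𝔽_C[1_P, K]𝔽_C⁻¹`", p. 33 L24).
For Schwartz `f, φ` and every `s`: the position-side action `∫ k_f(s,t)φ(t)dt` of `[H,f]` (App. E (quantdiff))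
equals `−2 ∫_ξ e^{2πisξ} (∫_η b_f(ξ,η) φ̂(η) dη) dξ`, `b_f(ξ,η) = f̂(ξ−η)(1_{ξ>0≥η} − 1_{ξ≤0<η})`, `φ̂ = 𝓕φ`
(Mathlib kernel `e^{−2πiηt}`): the first of the two Fubini exchanges identifying the Schwartz matrix coefficients
of `[H,f]` with those of the frequency-side Hilbert–Schmidt operator (`FourierConjugateSchwartz`).
Pass 2 (`integral_conj_quantizedDiff_mul_eq_fourierSide`) performs the second exchange (over `(s, ξ)`, dominated by
`2|ψ(s)||∫_η b_f φ̂|`): `∫ conj(∫ k_f(s,t)φ(t)dt) ψ(s) ds = ∫ conj(∫ (−2 b_f(ξ,η)) φ̂(η) dη) ψ̂(ξ) dξ`, i.e.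
`⟪[H,f]φ, ψ⟫ = ⟪Bφ̂, ψ̂⟫` with `K_B = −2 b_f` — the hypothesis of `fourierConj_eq_of_inner_schwartz`.
WHAT THIS IS NOT: any claim about RH.  Theorems only; no definition, no named fact (net debt 0).
-/

noncomputable section

open MeasureTheory Complex Set
open scoped Real FourierTransform

namespace Literature.NumberTheory.ConnesConsani2021

/-- RH-FREE. **`[H,f]φ` through the frequency kernel** (first Fubini exchange): for Schwartz `f, φ` and all `s`,
`∫ k_f(s,t) φ(t) dt = −2 ∫_ξ e^{2πisξ} (∫_η b_f(ξ,η) φ̂(η) dη) dξ`.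
[cite: ConnesConsani2021, App. D Lemma 47 proof p. 33 (arXiv chunk p0033:L24–36); App. E eq. (quantdiff) p. 34] -/
theorem integral_quantizedDiffKernel_mul_eq_fourierSide (f φ : SchwartzMap ℝ ℂ) (s : ℝ) :
    ∫ t : ℝ, quantizedDiffKernel f s t * φ t =
      -2 * ∫ ξ : ℝ, cexp (2 * π * I * (s * ξ)) * ∫ η : ℝ, 𝓕 (f : ℝ → ℂ) (ξ - η) *
        ((if 0 < ξ ∧ η ≤ 0 then (1 : ℂ) else 0) - (if ξ ≤ 0 ∧ 0 < η then (1 : ℂ) else 0)) *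
          𝓕 (φ : ℝ → ℂ) η := by
  -- notation-free abbreviations
  set b : ℝ × ℝ → ℂ := Function.uncurry fun ξ η : ℝ => 𝓕 (f : ℝ → ℂ) (ξ - η) *
    ((if 0 < ξ ∧ η ≤ 0 then (1 : ℂ) else 0) - (if ξ ≤ 0 ∧ 0 < η then (1 : ℂ) else 0)) with hb
  have hbint : Integrable b ((volume : Measure ℝ).prod volume) := integrable_quadrantKernel f
  have hbmeas : Measurable b := measurable_quadrantKernel f
  -- Step 1: insert the double-integral representation of `k_f` (valid off the diagonal, a null set)
  have hae : ∀ᵐ t : ℝ ∂volume, t ≠ s := by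
    have : (volume : Measure ℝ) {t | ¬ t ≠ s} = 0 := by
      have hset : {t : ℝ | ¬ t ≠ s} = {s} := by ext t; simp
      rw [hset, measure_singleton]
    exact ae_iff.2 this
  have h1 : ∫ t : ℝ, quantizedDiffKernel f s t * φ t =
      ∫ t : ℝ, (-2 * ∫ p : ℝ × ℝ, b p * cexp (2 * π * I * (s * p.1 - t * p.2)) ∂(volume.prod volume)) * φ t := by
    refine integral_congr_ae ?_
    filter_upwards [hae] with t ht
    rw [quantizedDiffKernel_eq_integral_integral_quadrant f (Ne.symm ht)]
    congr 2
    -- iterated integral = product integral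
    have hint : Integrable (fun p : ℝ × ℝ => b p * cexp (2 * π * I * (s * p.1 - t * p.2)))
        ((volume : Measure ℝ).prod volume) := by
      refine hbint.mul_bdd (c := 1) ?_ (Filter.Eventually.of_forall fun p => ?_)
      · exact (by fun_prop : Continuous fun p : ℝ × ℝ =>
          cexp (2 * π * I * (s * p.1 - t * p.2))).aestronglyMeasurable
      · rw [Complex.norm_exp]; simp
    rw [integral_prod _ hint]
    refine integral_congr_ae (Filter.Eventually.of_forall fun ξ => ?_)
    refine integral_congr_ae (Filter.Eventually.of_forall fun η => ?_)
    simp only [hb, Function.uncurry_apply_pair]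
    ring
  rw [h1]
  -- Step 2: Fubini over `(t, p)`; the integrand is dominated by `2‖φ t‖ ‖b p‖`
  have h2 : ∀ t : ℝ, (-2 * ∫ p : ℝ × ℝ, b p * cexp (2 * π * I * (s * p.1 - t * p.2)) ∂(volume.prod volume)) * φ t =
      ∫ p : ℝ × ℝ, -2 * (φ t * (b p * cexp (2 * π * I * (s * p.1 - t * p.2)))) ∂(volume.prod volume) := by
    intro t
    rw [integral_const_mul, integral_const_mul]
    ring
  simp_rw [h2]
  have hF : Integrable (Function.uncurry fun (t : ℝ) (p : ℝ × ℝ) =>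
      -2 * (φ t * (b p * cexp (2 * π * I * (s * p.1 - t * p.2)))))
      ((volume : Measure ℝ).prod ((volume : Measure ℝ).prod volume)) := by
    have hdom : Integrable (fun z : ℝ × (ℝ × ℝ) => ((-2 : ℂ) * φ z.1) * b z.2)
        ((volume : Measure ℝ).prod ((volume : Measure ℝ).prod volume)) :=
      (φ.integrable.const_mul (-2 : ℂ)).mul_prod hbint
    refine hdom.mono ?_ (Filter.Eventually.of_forall ?_)
    · refine Measurable.aestronglyMeasurable ?_
      refine measurable_const.mul ((φ.continuous.measurable.comp measurable_fst).mul
        ((hbmeas.comp measurable_snd).mul ?_))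
      exact (by fun_prop : Continuous fun z : ℝ × (ℝ × ℝ) =>
        cexp (2 * π * I * (s * z.2.1 - z.1 * z.2.2))).measurable
    · rintro ⟨t, p⟩
      have he : ‖cexp (2 * π * I * (s * p.1 - t * p.2))‖ = 1 := by
        rw [Complex.norm_exp]; simp
      simp only [Function.uncurry_apply_pair, norm_mul, he, mul_one]
      exact le_of_eq (by ring)
  rw [integral_integral_swap hF]
  -- Step 3: the inner `t`-integral is `φ̂(η)`; back to an iterated integral in `(ξ, η)`
  have h3 : ∀ p : ℝ × ℝ, ∫ t : ℝ, -2 * (φ t * (b p * cexp (2 * π * I * (s * p.1 - t * p.2)))) =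
      -2 * (cexp (2 * π * I * (s * p.1)) * (b p * 𝓕 (φ : ℝ → ℂ) p.2)) := by
    intro p
    rw [Real.fourier_real_eq_integral_exp_smul, ← integral_const_mul, ← integral_const_mul,
      ← integral_const_mul]
    refine integral_congr_ae (Filter.Eventually.of_forall fun t => ?_)
    simp only [smul_eq_mul]
    have hexp : cexp (2 * π * I * (s * p.1 - t * p.2)) =
        cexp (2 * π * I * (s * p.1)) * cexp (↑(-2 * π * t * p.2) * I) := by
      rw [← Complex.exp_add]; congr 1; push_cast; ring
    rw [hexp]; ring
  simp_rw [h3]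
  have hint2 : Integrable (fun p : ℝ × ℝ => b p * (cexp (2 * π * I * (s * p.1)) * 𝓕 (φ : ℝ → ℂ) p.2))
      ((volume : Measure ℝ).prod volume) := by
    obtain ⟨C, hC⟩ : ∃ C : ℝ, ∀ η : ℝ, ‖𝓕 (φ : ℝ → ℂ) η‖ ≤ C := by
      refine ⟨SchwartzMap.seminorm ℝ 0 0 (𝓕 φ), fun η => ?_⟩
      have h := SchwartzMap.norm_le_seminorm ℝ (𝓕 φ) η
      rwa [show ((𝓕 φ : SchwartzMap ℝ ℂ) : ℝ → ℂ) η = 𝓕 (φ : ℝ → ℂ) η from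
        congrFun (SchwartzMap.fourier_coe φ) η] at h
    have hFc : Continuous (𝓕 (φ : ℝ → ℂ)) := by
      simpa [SchwartzMap.fourier_coe] using (𝓕 φ).continuous
    refine hbint.mul_bdd (c := C) ?_ (Filter.Eventually.of_forall fun p => ?_)
    · exact ((by fun_prop : Continuous fun p : ℝ × ℝ => cexp (2 * π * I * (s * p.1))).mul
        (hFc.comp continuous_snd)).aestronglyMeasurable
    · have he : ‖cexp (2 * π * I * (s * p.1))‖ = 1 := by rw [Complex.norm_exp]; simp
      rw [norm_mul, he, one_mul]; exact hC p.2
  have h4 : ∫ p : ℝ × ℝ, -2 * (cexp (2 * π * I * (s * p.1)) * (b p * 𝓕 (φ : ℝ → ℂ) p.2)) ∂(volume.prod volume) =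
      -2 * ∫ p : ℝ × ℝ, b p * (cexp (2 * π * I * (s * p.1)) * 𝓕 (φ : ℝ → ℂ) p.2) ∂(volume.prod volume) := by
    rw [← integral_const_mul]
    refine integral_congr_ae (Filter.Eventually.of_forall fun p => ?_)
    ring
  rw [h4, integral_prod _ hint2]
  congr 1
  refine integral_congr_ae (Filter.Eventually.of_forall fun ξ => ?_)
  dsimp only
  rw [← integral_const_mul]
  refine integral_congr_ae (Filter.Eventually.of_forall fun η => ?_)
  simp only [hb, Function.uncurry_apply_pair]
  ring

/-- RH-FREE. **Schwartz matrix coefficients of `[H, f]` through the frequency kernel** (second Fubini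
exchange): for Schwartz `f, φ, ψ`,
`∫_s conj(∫_t k_f(s,t)φ(t)dt)·ψ(s) ds = ∫_ξ conj(∫_η (−2 b_f(ξ,η)) φ̂(η) dη)·ψ̂(ξ) dξ`
— i.e. `⟪[H,f]φ, ψ⟫_{L²} = ⟪B φ̂, ψ̂⟫_{L²}` for the Hilbert–Schmidt operator `B` with kernel `K_B = −2 b_f`
(`⟪z, w⟫_ℂ = conj z · w`), the hypothesis of `fourierConj_eq_of_inner_schwartz`.
[cite: ConnesConsani2021, App. D Lemma 47 proof p. 33 (arXiv chunk p0033:L24–36); App. E eq. (quantdiff) p. 34] -/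
theorem integral_conj_quantizedDiff_mul_eq_fourierSide (f φ ψ : SchwartzMap ℝ ℂ) :
    ∫ s : ℝ, (starRingEnd ℂ) (∫ t : ℝ, quantizedDiffKernel f s t * φ t) * ψ s =
      ∫ ξ : ℝ, (starRingEnd ℂ) (∫ η : ℝ, (-2) * (𝓕 (f : ℝ → ℂ) (ξ - η) *
        ((if 0 < ξ ∧ η ≤ 0 then (1 : ℂ) else 0) - (if ξ ≤ 0 ∧ 0 < η then (1 : ℂ) else 0))) *
          𝓕 (φ : ℝ → ℂ) η) * 𝓕 (ψ : ℝ → ℂ) ξ := by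
  set b : ℝ × ℝ → ℂ := Function.uncurry fun ξ η : ℝ => 𝓕 (f : ℝ → ℂ) (ξ - η) *
    ((if 0 < ξ ∧ η ≤ 0 then (1 : ℂ) else 0) - (if ξ ≤ 0 ∧ 0 < η then (1 : ℂ) else 0)) with hb
  have hbint : Integrable b ((volume : Measure ℝ).prod volume) := integrable_quadrantKernel f
  have hbmeas : Measurable b := measurable_quadrantKernel f
  have hFc : Continuous (𝓕 (φ : ℝ → ℂ)) := by
    simpa [SchwartzMap.fourier_coe] using (𝓕 φ).continuous
  obtain ⟨C, hC⟩ : ∃ C : ℝ, ∀ η : ℝ, ‖𝓕 (φ : ℝ → ℂ) η‖ ≤ C := by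
    refine ⟨SchwartzMap.seminorm ℝ 0 0 (𝓕 φ), fun η => ?_⟩
    have h := SchwartzMap.norm_le_seminorm ℝ (𝓕 φ) η
    rwa [show ((𝓕 φ : SchwartzMap ℝ ℂ) : ℝ → ℂ) η = 𝓕 (φ : ℝ → ℂ) η from
      congrFun (SchwartzMap.fourier_coe φ) η] at h
  -- `β(ξ) = ∫_η b(ξ,η) φ̂(η) dη` is integrable
  have hbφ : Integrable (fun p : ℝ × ℝ => b p * 𝓕 (φ : ℝ → ℂ) p.2) ((volume : Measure ℝ).prod volume) :=
    hbint.mul_bdd (c := C) (hFc.comp continuous_snd).aestronglyMeasurable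
      (Filter.Eventually.of_forall fun p => hC p.2)
  set β : ℝ → ℂ := fun ξ => ∫ η : ℝ, b (ξ, η) * 𝓕 (φ : ℝ → ℂ) η with hβ
  have hβint : Integrable β := hbφ.integral_prod_left
  -- Step 1: the first exchange, and `conj` through the `ξ`-integral
  have h1 : ∀ s : ℝ, (starRingEnd ℂ) (∫ t : ℝ, quantizedDiffKernel f s t * φ t) * ψ s =
      ∫ ξ : ℝ, -2 * ((starRingEnd ℂ) (cexp (2 * π * I * (s * ξ))) * (starRingEnd ℂ) (β ξ) * ψ s) := by
    intro s
    rw [integral_quantizedDiffKernel_mul_eq_fourierSide]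
    have hrw : (∫ ξ : ℝ, cexp (2 * π * I * (s * ξ)) * ∫ η : ℝ, 𝓕 (f : ℝ → ℂ) (ξ - η) *
        ((if 0 < ξ ∧ η ≤ 0 then (1 : ℂ) else 0) - (if ξ ≤ 0 ∧ 0 < η then (1 : ℂ) else 0)) *
          𝓕 (φ : ℝ → ℂ) η) = ∫ ξ : ℝ, cexp (2 * π * I * (s * ξ)) * β ξ := by
      refine integral_congr_ae (Filter.Eventually.of_forall fun ξ => ?_)
      simp only [hβ, hb, Function.uncurry_apply_pair]
    rw [hrw, map_mul, ← integral_conj, mul_assoc, ← integral_mul_const, ← integral_const_mul]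
    refine integral_congr_ae (Filter.Eventually.of_forall fun ξ => ?_)
    simp only [map_mul, map_neg, map_ofNat, mul_assoc]
  simp_rw [h1]
  -- Step 2: Fubini over `(s, ξ)`, dominated by `2 |ψ(s)| |β(ξ)|`
  have hF : Integrable (Function.uncurry fun (s ξ : ℝ) =>
      -2 * ((starRingEnd ℂ) (cexp (2 * π * I * (s * ξ))) * (starRingEnd ℂ) (β ξ) * ψ s))
      ((volume : Measure ℝ).prod volume) := by
    have hβconj : Integrable (fun ξ : ℝ => (starRingEnd ℂ) (β ξ)) :=
      hβint.mono (Complex.continuous_conj.comp_aestronglyMeasurable hβint.aestronglyMeasurable)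
        (Filter.Eventually.of_forall fun ξ => by rw [Complex.norm_conj])
    have hdom : Integrable (fun z : ℝ × ℝ => ((-2 : ℂ) * ψ z.1) * (starRingEnd ℂ) (β z.2))
        ((volume : Measure ℝ).prod volume) :=
      (ψ.integrable.const_mul (-2 : ℂ)).mul_prod hβconj
    refine hdom.mono ?_ (Filter.Eventually.of_forall ?_)
    · refine (AEStronglyMeasurable.const_mul ?_ (-2 : ℂ))
      refine ((AEStronglyMeasurable.mul ?_ ?_).mul ?_)
      · exact (Complex.continuous_conj.comp (by fun_prop : Continuous fun z : ℝ × ℝ =>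
          cexp (2 * π * I * (z.1 * z.2)))).aestronglyMeasurable
      · exact (Complex.continuous_conj.comp_aestronglyMeasurable hβint.aestronglyMeasurable).comp_snd
      · exact (ψ.continuous.comp continuous_fst).aestronglyMeasurable
    · rintro ⟨s, ξ⟩
      have he : ‖(starRingEnd ℂ) (cexp (2 * π * I * (s * ξ)))‖ = 1 := by
        rw [Complex.norm_conj, Complex.norm_exp]; simp
      simp only [Function.uncurry_apply_pair, norm_mul, he, one_mul]
      exact le_of_eq (by ring)
  rw [integral_integral_swap hF]
  -- Step 3: the inner `s`-integral is `ψ̂(ξ)`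
  refine integral_congr_ae (Filter.Eventually.of_forall fun ξ => ?_)
  dsimp only
  have hinner : (starRingEnd ℂ) (∫ η : ℝ, -2 * (𝓕 (f : ℝ → ℂ) (ξ - η) *
      ((if 0 < ξ ∧ η ≤ 0 then (1 : ℂ) else 0) - (if ξ ≤ 0 ∧ 0 < η then (1 : ℂ) else 0))) *
        𝓕 (φ : ℝ → ℂ) η) = -2 * (starRingEnd ℂ) (β ξ) := by
    have : (∫ η : ℝ, -2 * (𝓕 (f : ℝ → ℂ) (ξ - η) *
        ((if 0 < ξ ∧ η ≤ 0 then (1 : ℂ) else 0) - (if ξ ≤ 0 ∧ 0 < η then (1 : ℂ) else 0))) *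
          𝓕 (φ : ℝ → ℂ) η) = -2 * β ξ := by
      rw [hβ, ← integral_const_mul]
      refine integral_congr_ae (Filter.Eventually.of_forall fun η => ?_)
      simp only [hb, Function.uncurry_apply_pair]
      ring
    rw [this, map_mul, map_neg, map_ofNat]
  rw [hinner, Real.fourier_real_eq_integral_exp_smul, ← integral_const_mul]
  refine integral_congr_ae (Filter.Eventually.of_forall fun s => ?_)
  simp only [smul_eq_mul]
  have hexp : (starRingEnd ℂ) (cexp (2 * π * I * (s * ξ))) = cexp (↑(-2 * π * s * ξ) * I) := by
    rw [← Complex.exp_conj]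
    congr 1
    simp only [map_mul, Complex.conj_ofReal, Complex.conj_I, map_ofNat]
    push_cast
    ring
  rw [hexp]
  ring

end Literature.NumberTheory.ConnesConsani2021
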